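import Summits.CriticalPhenomena.PercolationContinuityZ3.Theorems.PercNearOneGluingNoHeavyLowerTailProdWeightPivot
import Literature.Probability.Percolation.OpenGraphCuts
import HarnessLib

/-!
# Contraction of a sure pair on the same vertex type — preliminaries (transfer of coordinates, reachability)

Support file for crux `stmt-CriticalPhenomena-4575` (`NoHeavyLowerTail`), seat `prim-facecert` gen 20
(`--supports stmt-CriticalPhenomena-4575`; all-graphs `(Q6)_port`/`(C½)` programme, paper proof prim-l12-p1 gen 22, memo
`run/shared/lean/prim/prim-l12/FROM-prim-l12-p1-g22-CHALF-ALL-GRAPHS.md` §8).  No definitions, no sorries, standard axioms.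

Bernoulli percolation `prodBernoulli w` on `BondConfig V = Set (Sym2 V)`, finite `V`, arbitrary pair weights.  To contract a pair
`{u,v}` of weight `1` WITHOUT quotient types one TRANSFERS the pairs at `v` to `u`: along a list of vertices `x` the coordinate
`s(v,x)` is OR-merged into `s(u,x)` (`…ProdWeightPivot.sum_weight_merge`; new weight `1 − (1 − w s(u,x))(1 − w s(v,x))`, and `0` at
`s(v,x)`), and then the pairs at `v` are removed (`sum_weight_delete`).  This file: the finite-sum transformation rules
(`sum_weight_transfer`, `sum_weight_removeList`), the bookkeeping of the transferred weights (`transfer_props`), and the two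
connectivity facts — an OR-merge of `s(v,x)` into `s(u,x)` does not change reachability when `s(u,v)` is open (`reachable_merge_iff`,
`reachable_transfer_iff`), and removing the pairs at a leaf does not change reachability between the other vertices
(`reachable_removeAt_iff`).  The fold itself is `…EdgeContraction.exists_fold`.  `update_self_inst`/`update_of_ne_inst` evaluate
`Function.update` under an explicitly given (possibly non-canonical) decidability instance, which is how the classical instances of
the generic coordinate lemmas are reconciled with the canonical ones.
[cite: Grimmett1999, §1.6 (contraction/deletion of edges), §2.2 (events depending on finitely many edges)]
-/

noncomputable section

namespace Summit.CriticalPhenomena.PercolationContinuityZ3.Theorems.EdgeContraction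

open MeasureTheory Set
open Literature.Probability.Percolation Literature.Probability.Percolation.BHK2006
open Literature.Probability.LatticeModels (prodBernoulli)
open Summit.CriticalPhenomena.PercolationContinuityZ3.Theorems.ProdWeightPivot
open scoped Classical

/-! ## `Function.update` with an explicit decidability instance -/

section UpdateInst

variable {ι β : Type*}

/-- `Function.update` at the updated point, for an ARBITRARY decidability instance given explicitly (so that terms carrying a
non-canonical instance — e.g. the classical one of the generic coordinate lemmas — can be rewritten). [folklore] -/
theorem update_self_inst (inst : DecidableEq ι) (f : ι → β) (a : ι) (v : β) :
    @Function.update ι (fun _ => β) inst f a v a = v := by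
  unfold Function.update; rw [dif_pos rfl]

/-- `Function.update` off the updated point, for an arbitrary decidability instance given explicitly. [folklore] -/
theorem update_of_ne_inst (inst : DecidableEq ι) (f : ι → β) {a i : ι} (v : β) (h : i ≠ a) :
    @Function.update ι (fun _ => β) inst f a v i = f i := by
  unfold Function.update; rw [dif_neg h]

end UpdateInst

/-! ## Walk helpers -/

section Reach

variable {V : Type*}

/-- If every edge of `G` joins vertices whose images are `H`-reachable from each other, then `G`-reachability
maps to `H`-reachability. [folklore] -/
theorem reachable_map_of_adj {G H : SimpleGraph V} (φ : V → V)
    (h : ∀ a b, G.Adj a b → H.Reachable (φ a) (φ b)) {y z : V} (hyz : G.Reachable y z) :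
    H.Reachable (φ y) (φ z) := by
  obtain ⟨p⟩ := hyz
  induction p with
  | nil => exact SimpleGraph.Reachable.refl _
  | cons hadj _ ih => exact (h _ _ hadj).trans ih

/-- Special case `φ = id`. [folklore] -/
theorem reachable_of_adj_reachable {G H : SimpleGraph V}
    (h : ∀ a b, G.Adj a b → H.Reachable a b) {y z : V} (hyz : G.Reachable y z) : H.Reachable y z :=
  reachable_map_of_adj (G := G) (H := H) id h hyz

/-- The pair `s(u,v)` survives the OR-merge of `s(v,x)` into `s(u,x)` (`x ≠ u`). [folklore] -/
theorem mem_merge_of_mem {u v x : V} (hxu : x ≠ u) {ω : BondConfig V} (hω : s(u, v) ∈ ω) :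
    s(u, v) ∈ (if s(v, x) ∈ ω then insert s(u, x) ω else ω) \ {s(v, x)} := by
  have hne : s(u, v) ≠ s(v, x) := by
    rw [Ne, Sym2.eq_iff]; rintro (⟨h1, h2⟩ | ⟨h1, -⟩) <;> [exact hxu (h1.trans h2).symm; exact hxu h1.symm]
  refine ⟨?_, hne⟩
  by_cases h : s(v, x) ∈ ω
  · rw [if_pos h]; exact mem_insert_of_mem _ hω
  · rw [if_neg h]; exact hω

/-- **One OR-merge step preserves connectivity when the pair `s(u,v)` is open**: merging the coordinate `s(v,x)` into
`s(u,x)` does not change the reachability relation. [folklore] -/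
theorem reachable_merge_iff {u v x : V} (huv : u ≠ v) (hxu : x ≠ u) (hxv : x ≠ v) {ω : BondConfig V}
    (hω : s(u, v) ∈ ω) (y z : V) :
    (openGraph ((if s(v, x) ∈ ω then insert s(u, x) ω else ω) \ {s(v, x)})).Reachable y z ↔
      (openGraph ω).Reachable y z := by
  have hij : s(u, x) ≠ s(v, x) := by
    rw [Ne, Sym2.eq_iff]; rintro (⟨h, -⟩ | ⟨h1, h2⟩) <;> [exact huv h; exact huv (h1.trans h2)]
  set ω' := (if s(v, x) ∈ ω then insert s(u, x) ω else ω) \ {s(v, x)} with hω'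
  have hmem : ∀ k, k ∈ ω' ↔ (k ∈ ω ∧ k ≠ s(v, x)) ∨ (k = s(u, x) ∧ s(v, x) ∈ ω) := fun k => by
    rw [hω']; exact mem_merge_iff hij ω k
  have huv' : s(u, v) ∈ ω' := by
    rw [hmem]; left; refine ⟨hω, ?_⟩
    rw [Ne, Sym2.eq_iff]; rintro (⟨h, -⟩ | ⟨h1, -⟩) <;> [exact huv h; exact hxu h1.symm]
  constructor
  · refine reachable_of_adj_reachable fun a b hab => ?_
    rw [openGraph_adj] at hab
    obtain ⟨hab, hne⟩ := hab
    rcases (hmem _).1 hab with ⟨h, -⟩ | ⟨h, hvx⟩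
    · exact reachable_openGraph_of_mem _ h hne
    · -- the new pair `s(u,x)`: in `ω`, `u ~ v ~ x`
      have hux : (openGraph ω).Reachable u x :=
        (reachable_openGraph_of_mem _ hω huv).trans (reachable_openGraph_of_mem _ hvx hxv.symm)
      rcases Sym2.eq_iff.1 h with ⟨rfl, rfl⟩ | ⟨rfl, rfl⟩
      · exact hux
      · exact hux.symm
  · refine reachable_of_adj_reachable fun a b hab => ?_
    rw [openGraph_adj] at hab
    obtain ⟨hab, hne⟩ := hab
    by_cases hk : s(a, b) = s(v, x)
    · -- the deleted pair `s(v,x)`: in `ω'`, `v ~ u ~ x`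
      have h1 : (openGraph ω').Reachable v x :=
        (reachable_openGraph_of_mem _ huv' huv).symm.trans (reachable_openGraph_of_mem _ ((hmem _).2 (Or.inr ⟨rfl, hk ▸ hab⟩)) hxu.symm)
      rcases Sym2.eq_iff.1 hk with ⟨rfl, rfl⟩ | ⟨rfl, rfl⟩
      · exact h1
      · exact h1.symm
    · exact reachable_openGraph_of_mem _ ((hmem _).2 (Or.inl ⟨hab, hk⟩)) hne

/-- **Removing the pairs at a leaf**: if the only non-loop open pair at `v` is (possibly) `s(u,v)`, then deleting all pairs
containing `v` does not change reachability between vertices other than `v`. [folklore] -/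
theorem reachable_removeAt_iff {u v : V} {ω : BondConfig V}
    (hleaf : ∀ x, x ≠ v → x ≠ u → s(v, x) ∉ ω) {y z : V} (hy : y ≠ v) (hz : z ≠ v) :
    (openGraph (ω \ {e | v ∈ e})).Reachable y z ↔ (openGraph ω).Reachable y z := by
  constructor
  · exact fun h => h.mono (openGraph_mono sdiff_subset)
  · intro h
    -- collapse `v` onto `u`
    set φ : V → V := fun t => if t = v then u else t with hφ
    have hφy : φ y = y := by simp [hφ, hy]
    have hφz : φ z = z := by simp [hφ, hz]
    rw [← hφy, ← hφz]
    refine reachable_map_of_adj φ (fun a b hab => ?_) h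
    rw [openGraph_adj] at hab
    obtain ⟨hab, hne⟩ := hab
    by_cases ha : a = v
    · -- then `b = u`
      subst ha
      have hb : b = u := by
        by_contra hbu; exact hleaf b hne.symm hbu hab
      simp [hφ, hb]
    · by_cases hb : b = v
      · subst hb
        have ha' : a = u := by
          by_contra hau; exact hleaf a hne hau (by rw [Sym2.eq_swap]; exact hab)
        simp [hφ, ha']
      · simp only [hφ, ha, hb, if_false]
        refine reachable_openGraph_of_mem _ ?_ hne
        exact ⟨hab, fun hv => by rcases Sym2.mem_iff.1 hv with rfl | rfl <;> simp_all⟩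

end Reach

/-! ## The transfer of the pairs at `v` to `u`, and the removal of the pairs at `v`: finite-sum level -/

section Sums

variable {V : Type*} [Fintype V]

/-- **Transfer** (iterated OR-merge of `s(v,x)` into `s(u,x)` along a list of vertices `x`): the weighted sum transforms
with the iterated merged parameters. [folklore] -/
theorem sum_weight_transfer (u v : V) (huv : u ≠ v) :
    ∀ (l : List V) (w : Sym2 V → ℝ) (f : BondConfig V → ℝ),
      ∑ ω, weight w ω * f (l.foldl (fun ω x => (if s(v, x) ∈ ω then insert s(u, x) ω else ω) \ {s(v, x)}) ω) =
        ∑ ω, weight (l.foldl (fun w x => Function.update (Function.update w s(v, x) 0) s(u, x)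
          (1 - (1 - w s(u, x)) * (1 - w s(v, x)))) w) ω * f ω
  | [], w, f => by simp
  | x :: xs, w, f => by
      simp only [List.foldl_cons]
      have hij : s(u, x) ≠ s(v, x) := by
        rw [Ne, Sym2.eq_iff]; rintro (⟨h, -⟩ | ⟨h1, h2⟩) <;> [exact huv h; exact huv (h1.trans h2)]
      rw [sum_weight_merge w hij (fun ω => f (xs.foldl
        (fun ω x => (if s(v, x) ∈ ω then insert s(u, x) ω else ω) \ {s(v, x)}) ω))]
      rw [← sum_weight_transfer u v huv xs (Function.update (Function.update w s(v, x) 0) s(u, x)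
        (1 - (1 - w s(u, x)) * (1 - w s(v, x)))) f]
      refine Finset.sum_congr rfl fun ω _ => ?_
      congr 2
      funext k
      by_cases h1 : k = s(u, x)
      · subst h1; rw [update_self_inst, update_self_inst]
      · rw [update_of_ne_inst _ _ _ h1, update_of_ne_inst _ _ _ h1]
        by_cases h2 : k = s(v, x)
        · subst h2; rw [update_self_inst, update_self_inst]
        · rw [update_of_ne_inst _ _ _ h2, update_of_ne_inst _ _ _ h2]

omit [Fintype V] in
/-- The transfer preserves reachability on configurations containing `s(u,v)`. [folklore] -/
theorem reachable_transfer_iff (u v : V) (huv : u ≠ v) :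
    ∀ (l : List V), (∀ x ∈ l, x ≠ u ∧ x ≠ v) → ∀ (ω : BondConfig V), s(u, v) ∈ ω → ∀ y z,
      ((openGraph (l.foldl (fun ω x => (if s(v, x) ∈ ω then insert s(u, x) ω else ω) \ {s(v, x)}) ω)).Reachable y z ↔
        (openGraph ω).Reachable y z)
  | [], _, ω, _, y, z => by simp
  | x :: xs, hl, ω, hω, y, z => by
      simp only [List.foldl_cons]
      have hx := hl x (by simp)
      rw [reachable_transfer_iff u v huv xs (fun x' hx' => hl x' (by simp [hx'])) _ (mem_merge_of_mem hx.1 hω) y z]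
      exact reachable_merge_iff huv hx.1 hx.2 hω y z

omit [Fintype V] in
/-- Bookkeeping for the transferred parameters: values in `[0,1]` are preserved, the pair `s(u,v)` keeps its parameter,
parameters `< 1` off `s(u,v)` stay `< 1`, the pairs `s(v,x)` (`x` in the list) get parameter `0`, and every pair of positive
parameter either had positive parameter or is a pair `s(u,x)` with `w s(v,x) > 0`. [folklore] -/
theorem transfer_props (u v : V) (huv : u ≠ v) :
    ∀ (l : List V), (∀ x ∈ l, x ≠ u ∧ x ≠ v) → ∀ (w : Sym2 V → ℝ), (∀ e, 0 ≤ w e ∧ w e ≤ 1) →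
      let W := l.foldl (fun w x => Function.update (Function.update w s(v, x) 0) s(u, x)
          (1 - (1 - w s(u, x)) * (1 - w s(v, x)))) w
      (∀ e, 0 ≤ W e ∧ W e ≤ 1) ∧ W s(u, v) = w s(u, v) ∧
        ((∀ e, e ≠ s(u, v) → w e < 1) → ∀ e, e ≠ s(u, v) → W e < 1) ∧
        (∀ x ∈ l, W s(v, x) = 0) ∧ (∀ e, v ∈ e → W e = w e ∨ W e = 0) ∧
        (∀ e, 0 < W e → 0 < w e ∨ ∃ x ∈ l, e = s(u, x) ∧ 0 < w s(v, x))
  | [], _, w, hw => by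
      refine ⟨hw, rfl, fun h => h, by simp, fun e _ => Or.inl rfl, fun e he => Or.inl he⟩
  | x :: xs, hl, w, hw => by
      intro W
      have hx := hl x (by simp)
      have hij : s(u, x) ≠ s(v, x) := by
        rw [Ne, Sym2.eq_iff]; rintro (⟨h, -⟩ | ⟨h1, h2⟩) <;> [exact huv h; exact huv (h1.trans h2)]
      set w₁ := Function.update (Function.update w s(v, x) 0) s(u, x) (1 - (1 - w s(u, x)) * (1 - w s(v, x))) with hw₁
      have hw₁v : ∀ k, w₁ k = if k = s(u, x) then 1 - (1 - w s(u, x)) * (1 - w s(v, x))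
          else if k = s(v, x) then 0 else w k := by
        intro k; rw [hw₁]
        by_cases h1 : k = s(u, x)
        · rw [h1, Function.update_self, if_pos rfl]
        · rw [Function.update_of_ne h1, if_neg h1]
          by_cases h2 : k = s(v, x)
          · rw [h2, Function.update_self, if_pos rfl]
          · rw [Function.update_of_ne h2, if_neg h2]
      have hw₁01 : ∀ e, 0 ≤ w₁ e ∧ w₁ e ≤ 1 := by
        intro e; rw [hw₁v]
        have h1 := hw s(u, x); have h2 := hw s(v, x)
        split_ifs
        · constructor <;> nlinarith [mul_nonneg (sub_nonneg.2 h1.2) (sub_nonneg.2 h2.2)]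
        · exact ⟨le_rfl, zero_le_one⟩
        · exact hw e
      have IH := transfer_props u v huv xs (fun x' hx' => hl x' (by simp [hx'])) w₁ hw₁01
      have hWdef : W = xs.foldl (fun w x => Function.update (Function.update w s(v, x) 0) s(u, x)
          (1 - (1 - w s(u, x)) * (1 - w s(v, x)))) w₁ := rfl
      rw [hWdef]
      obtain ⟨I1, I2, I3, I4, I5, I6⟩ := IH
      have huvi : s(u, v) ≠ s(u, x) := by
        rw [Ne, Sym2.eq_iff]; rintro (⟨-, h⟩ | ⟨h1, -⟩) <;> [exact hx.2 h.symm; exact hx.1 h1.symm]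
      have huvj : s(u, v) ≠ s(v, x) := by
        rw [Ne, Sym2.eq_iff]; rintro (⟨h, -⟩ | ⟨h1, -⟩) <;> [exact huv h; exact hx.1 h1.symm]
      refine ⟨I1, ?_, ?_, ?_, ?_, ?_⟩
      · rw [I2, hw₁v, if_neg huvi, if_neg huvj]
      · intro hlt
        refine I3 fun e he => ?_
        rw [hw₁v]
        split_ifs with h1 h2
        · have a1 := hlt _ huvi.symm; have a2 := hlt _ huvj.symm
          have b1 := (hw s(u, x)).2; have b2 := (hw s(v, x)).2
          nlinarith [mul_pos (sub_pos.2 a1) (sub_pos.2 a2)]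
        · exact zero_lt_one
        · exact hlt e he
      · intro x' hx'
        rcases List.mem_cons.1 hx' with rfl | hx'
        · -- the pair `s(v,x)` has parameter `0` in `w₁` and stays `0` or unchanged
          rcases I5 s(v, x') (Sym2.mem_mk_left _ _) with h | h
          · rw [h, hw₁v, if_neg hij.symm, if_pos rfl]
          · exact h
        · exact I4 x' hx'
      · intro e hve
        rcases I5 e hve with h | h
        · rw [h, hw₁v]
          split_ifs with h1 h2
          · exact absurd (h1 ▸ hve : v ∈ s(u, x)) (by
              rw [Sym2.mem_iff]; rintro (h | h) <;> [exact huv h.symm; exact hx.2 h.symm])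
          · exact Or.inr rfl
          · exact Or.inl rfl
        · exact Or.inr h
      · intro e he
        rcases I6 e he with h | ⟨x', hx', rfl, hpos⟩
        · rw [hw₁v] at h
          split_ifs at h with h1 h2
          · -- `0 < 1 - (1 - w i)(1 - w j)` ⇒ `w i > 0 ∨ w j > 0`
            subst h1
            by_cases hi : 0 < w s(u, x)
            · exact Or.inl hi
            · right; refine ⟨x, by simp, rfl, ?_⟩
              by_contra hj
              have e1 : w s(u, x) = 0 := le_antisymm (not_lt.1 hi) (hw _).1
              have e2 : w s(v, x) = 0 := le_antisymm (not_lt.1 hj) (hw _).1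
              rw [e1, e2] at h; norm_num at h
          · exact absurd h (lt_irrefl 0)
          · exact Or.inl h
        · -- `0 < w₁ s(v,x')` with `x' ∈ xs`
          rw [hw₁v] at hpos
          split_ifs at hpos with h1 h2
          · exact absurd (h1 ▸ Sym2.mem_mk_left v x' : v ∈ s(u, x)) (by
              rw [Sym2.mem_iff]; rintro (h | h) <;> [exact huv h.symm; exact hx.2 h.symm])
          · exact absurd hpos (lt_irrefl 0)
          · exact Or.inr ⟨x', by simp [hx'], rfl, hpos⟩

/-- **Zeroing a list of coordinates**: `E_w[f(ω ∖ L)] = E_{w·1[∉ L]}[f]`. [folklore] -/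
theorem sum_weight_removeList {ι : Type*} [Fintype ι] :
    ∀ (L : List ι) (w : ι → ℝ) (f : Set ι → ℝ),
      ∑ ω, weight w ω * f (ω \ {e | e ∈ L}) = ∑ ω, weight (fun e => if e ∈ L then 0 else w e) ω * f ω
  | [], w, f => by
      have h1 : ∀ ω : Set ι, ω \ {e | e ∈ ([] : List ι)} = ω := fun ω => by ext; simp
      have h2 : (fun e => if e ∈ ([] : List ι) then (0 : ℝ) else w e) = w := by funext e; simp
      simp_rw [h1]; rw [h2]
  | e :: L, w, f => by
      have hset : ∀ ω : Set ι, ω \ {k | k ∈ e :: L} = (ω \ {e}) \ {k | k ∈ L} := by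
        intro ω; ext k; simp [not_or, and_assoc]
      simp_rw [hset]
      rw [sum_weight_delete w e (fun ω => f (ω \ {k | k ∈ L})), sum_weight_removeList L]
      congr 1; ext ω; congr 2
      funext k
      by_cases hk : k = e
      · subst hk; simp
      · simp [hk]

end Sums

end Summit.CriticalPhenomena.PercolationContinuityZ3.Theorems.EdgeContraction
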